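import Literature.Probability.RandomPlanarGeometry.HexSAWBrickWallBridgeBookkeeping
import Literature.Probability.RandomPlanarGeometry.HexSAWBrickWallBridges
import Literature.Probability.RandomPlanarGeometry.HexSAWBrickWallBridgeEnvelope
import Literature.Probability.RandomPlanarGeometry.HexSAWRunDensity
import Literature.Probability.RandomPlanarGeometry.SAWKestenInequalityAbstractNoGrowth
import Literature.Probability.RandomPlanarGeometry.HexSAWRatioEngine
import Literature.Probability.RandomPlanarGeometry.HexSAWTheorem1
import Literature.Probability.RandomPlanarGeometry.HexSAWHammersleyWelshLog
import Literature.Probability.RandomPlanarGeometry.SAWStretchedExponentialTail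
import HarnessLib

/-!
# Kesten's two-step ratio inequality for bridges of the honeycomb lattice («HEX-BRIDGE-RATIO-2», crux K76)

Topic `Literature/Probability/RandomPlanarGeometry` (lane «pcv-sawmu», route R76; continues
`HexSAWBrickWallBridgeSurgery.lean`, `HexSAWBrickWallBridgeBookkeeping.lean`). Source: N. Madras, G. Slade, *The
Self-Avoiding Walk* (1993), §7.3: Lemma 7.3.1 hypothesis (7.3.4) p. 242, Theorem 7.3.2 (proof, (7.3.5)–(7.3.11))
pp. 244–247, Theorem 7.3.4(d) p. 248; Corollary 3.1.6 (3.1.9) p. 61 (the bridge envelope).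

The two transfer counts (P1-B), (P2-B) over BRIDGES are the lane's (P1-ℍ), (P2-ℍ) (`HexSAWKestenTransfer`,
`HexSAWDoubleTransfer`) with the banded slots/sites and the constants `25 / 324 / (J_B+25)(J_B+50)`; the density (P3-B)
transports the exponential, pattern-free density of deletion-poor WALKS (`DetourDensityHex`, K1′-ℍ `HexSAWRunDensity`) to
bridges through the band defect `J ≤ J_B + 1` and the Hammersley–Welsh envelope `μ_ℍ^N ≤ μ_ℍ e^{6√N} b_N(ℍ)`
(`HexSAWBrickWallBridgeEnvelope`, a-p6) — the stretched exponential is absorbed by `(1/2)^{⌊N/Q⌋} e^{6√N} N³ ≤ 16 e^{81Q}`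
(`SAWStretchedExponentialTail.half_pow_div_mul_exp_mul_cube_le`);
the assembly is the no-growth abstract Kesten step `kesten_ineq_of_transfer_noGrowth` (a-p1) along each parity class,
merged by `kestenIneqTwo_of_parity`. Status in print: for `ℤ^d`, Kesten's inequality for BRIDGES is printed and proved —
Madras–Slade Theorem 7.3.2(b), (7.3.4) p. 244 (tree `Zd.MadrasSlade1993_thm732b`); for `ℍ` nothing is printed; this file is the
honeycomb port of that chapter, first written and kernel-checked here.

## Contents (namespace `Literature.Probability.RandomPlanarGeometry.SAW.HV`; all PROVED, axioms standard)

* `bridgeKesten_P1'`, `sum_card_bSlots_div_le`, `bridgeKesten_P2`;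
* `pow_le_mul_exp_mul_bridgeCount` (`μ^N ≤ μ e^{6√N} b_N`), **`hexBridgeLo : e^{−9√n} μ_ℍ^n ≤ b_n(ℍ)`** (all `n`),
  `bridgeKesten_P3_of`;
* `bridgeKestenTwo_parity`, **`hexBridgeKestenTwo_of (h : DetourDensityHex)`**, **`hexBridgeKestenTwo`** (unconditional).
-/

noncomputable section

open Finset Filter Topology Literature.Probability.LatticeModels SimpleGraph
open scoped BigOperators

namespace Literature.Probability.RandomPlanarGeometry.SAW.HV

section TransferB

/-- **(P1-B), the first counting over bridges** (Madras–Slade (7.3.6) restricted to bridges, inexact bookkeeping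
`c₁ = 25`): `#{ω' ∈ B_{N+2}(ℍ) : J_B(ω') ≥ 1} ≤ Σ_{ω ∈ B_N(ℍ)} I_B(ω)/max(J_B(ω) − 25, 1)`.
[cite: MadrasSlade1993, Theorem 7.3.2 (proof), (7.3.6)] -/
theorem bridgeKesten_P1' (N : ℕ) :
    (#((bridgeFin (N + 2)).filter fun ω' => 1 ≤ #(bSharp ω')) : ℝ) ≤
      ∑ ω ∈ bridgeFin N, (#(bSlots ω) : ℝ) / max ((#(bSharp ω) : ℝ) - 25) 1 := by
  have hJ : (#((bridgeFin (N + 2)).filter fun ω' => 1 ≤ #(bSharp ω')) : ℝ) =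
      ∑ ω ∈ bridgeFin (N + 2), (#(bSharp ω) : ℝ) * (1 / (#(bSharp ω) : ℝ)) := by
    rw [card_eq_sum_ones, Nat.cast_sum, sum_filter]
    refine sum_congr rfl fun ω _ => ?_
    by_cases h : 1 ≤ #(bSharp ω)
    · rw [if_pos h, Nat.cast_one, mul_one_div_cancel]
      exact_mod_cast (show #(bSharp ω) ≠ 0 by omega)
    · rw [if_neg h, show #(bSharp ω) = 0 by omega]
      simp
  rw [hJ, ← sum_bSharpPairs (N + 2) (fun ω => 1 / (#(bSharp ω) : ℝ)),
    ← sum_bSlotPairs_eq_sum_bSharpPairs N (fun p => 1 / (#(bSharp (hexIns p.2.1 p.2.2.1 p.2.2.2.1 p.2.2.2.2 p.1)) : ℝ))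
      (fun q => 1 / (#(bSharp q.1) : ℝ)) (fun p _ => rfl)]
  have hR : ∑ ω ∈ bridgeFin N, (#(bSlots ω) : ℝ) / max ((#(bSharp ω) : ℝ) - 25) 1 =
      ∑ p ∈ bSlotPairs N, 1 / max ((#(bSharp p.1) : ℝ) - 25) 1 := by
    rw [sum_bSlotPairs N (fun ω => 1 / max ((#(bSharp ω) : ℝ) - 25) 1)]
    refine sum_congr rfl fun ω _ => ?_
    rw [mul_one_div]
  rw [hR]
  refine sum_le_sum fun p hp => ?_
  obtain ⟨ω, m, x, y, z⟩ := p
  rw [bSlotPairs, mem_sigma] at hp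
  dsimp only at hp ⊢
  obtain ⟨hω, hs⟩ := hp
  have h1 : (1 : ℝ) ≤ #(bSharp (hexIns m x y z ω)) := by exact_mod_cast one_le_card_bSharp_hexIns hω hs
  have h2 : (#(bSharp ω) : ℝ) - 25 ≤ #(bSharp (hexIns m x y z ω)) := by
    have := card_bSharp_le_hexIns hω hs
    have h' : (#(bSharp ω) : ℝ) ≤ #(bSharp (hexIns m x y z ω)) + 25 := by exact_mod_cast this
    linarith
  exact one_div_le_one_div_of_le (lt_of_lt_of_le one_pos (le_max_right _ _)) (max_le h2 h1)

/-- **Level `N+2` of the double transfer over bridges**: `Σ_{ω' ∈ B_{N+2}(ℍ)} I_B(ω')/(J_B(ω')+25) ≤ b_{N+4}(ℍ)`.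
[cite: MadrasSlade1993, Theorem 7.3.2 (proof), eq. (7.3.7)] -/
theorem sum_card_bSlots_div_le (N : ℕ) :
    ∑ ω ∈ bridgeFin (N + 2), (#(bSlots ω) : ℝ) / ((#(bSharp ω) : ℝ) + 25) ≤ (#(bridgeFin (N + 4)) : ℝ) := by
  classical
  have e1 : ∑ ω ∈ bridgeFin (N + 2), (#(bSlots ω) : ℝ) / ((#(bSharp ω) : ℝ) + 25) =
      ∑ p ∈ bSlotPairs (N + 2), 1 / ((#(bSharp p.1) : ℝ) + 25) := by
    rw [sum_bSlotPairs (N + 2) (fun ω => 1 / ((#(bSharp ω) : ℝ) + 25))]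
    exact sum_congr rfl fun ω _ => by rw [mul_one_div]
  have e2 : ∑ p ∈ bSlotPairs (N + 2), 1 / ((#(bSharp p.1) : ℝ) + 25) ≤
      ∑ p ∈ bSlotPairs (N + 2), 1 / (#(bSharp (hexIns p.2.1 p.2.2.1 p.2.2.2.1 p.2.2.2.2 p.1)) : ℝ) := by
    refine sum_le_sum fun p hp => ?_
    rw [bSlotPairs, Finset.mem_sigma] at hp
    obtain ⟨hω, hs⟩ := hp
    have hs' : (p.2.1, p.2.2.1, p.2.2.2.1, p.2.2.2.2) ∈ bSlots p.1 := hs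
    have hJ1 := one_le_card_bSharp_hexIns hω hs'
    have hJ3 := card_bSharp_hexIns_le hω hs'
    have hpos : (0 : ℝ) < #(bSharp (hexIns p.2.1 p.2.2.1 p.2.2.2.1 p.2.2.2.2 p.1)) := by exact_mod_cast hJ1
    apply one_div_le_one_div_of_le hpos
    exact_mod_cast hJ3
  have e3 : ∑ p ∈ bSlotPairs (N + 2), 1 / (#(bSharp (hexIns p.2.1 p.2.2.1 p.2.2.2.1 p.2.2.2.2 p.1)) : ℝ) =
      ∑ q ∈ bSharpPairs (N + 2 + 2), 1 / (#(bSharp q.1) : ℝ) :=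
    sum_bSlotPairs_eq_sum_bSharpPairs (N + 2) _ (fun q => 1 / (#(bSharp q.1) : ℝ)) fun p _ => rfl
  have e4 : ∑ q ∈ bSharpPairs (N + 2 + 2), 1 / (#(bSharp q.1) : ℝ) ≤ (#(bridgeFin (N + 4)) : ℝ) := by
    rw [sum_bSharpPairs (N + 2 + 2) (fun ω => 1 / (#(bSharp ω) : ℝ)), show N + 4 = N + 2 + 2 by ring,
      Finset.card_eq_sum_ones, Nat.cast_sum]
    refine sum_le_sum fun ω _ => ?_
    by_cases h : #(bSharp ω) = 0
    · rw [h]; simp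
    · rw [mul_one_div_cancel (by exact_mod_cast h)]; simp
  rw [e1]
  exact e2.trans (e3.le.trans e4)

/-- **(P2-B), the double transfer over bridges** (Madras–Slade (7.3.7) restricted to bridges):
`Σ_{ω ∈ B_N(ℍ)} I_B(ω)·max(0, I_B(ω) − 324)/((J_B(ω)+25)(J_B(ω)+50)) ≤ b_{N+4}(ℍ)`.
[cite: MadrasSlade1993, Theorem 7.3.2 (proof), eq. (7.3.7) (p. 246)] -/
theorem bridgeKesten_P2 (N : ℕ) :
    ∑ ω ∈ bridgeFin N, (#(bSlots ω) : ℝ) * max 0 ((#(bSlots ω) : ℝ) - 324) /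
        (((#(bSharp ω) : ℝ) + 25) * ((#(bSharp ω) : ℝ) + 50)) ≤ (#(bridgeFin (N + 4)) : ℝ) := by
  classical
  refine le_trans ?_ (sum_card_bSlots_div_le N)
  set g : List HV → ℝ := fun ω' =>
    (#(bSlots ω') : ℝ) / (((#(bSharp ω') : ℝ) + 25) * (#(bSharp ω') : ℝ)) with hg
  have hB : ∑ ω' ∈ bridgeFin (N + 2), (#(bSharp ω') : ℝ) * g ω' ≤
      ∑ ω' ∈ bridgeFin (N + 2), (#(bSlots ω') : ℝ) / ((#(bSharp ω') : ℝ) + 25) := by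
    refine sum_le_sum fun ω' _ => ?_
    by_cases h : #(bSharp ω') = 0
    · rw [h]; simp only [Nat.cast_zero, zero_mul, zero_add]; positivity
    · have hpos : (0 : ℝ) < #(bSharp ω') := by exact_mod_cast Nat.pos_of_ne_zero h
      rw [hg]
      rw [show (#(bSharp ω') : ℝ) * ((#(bSlots ω') : ℝ) /
          (((#(bSharp ω') : ℝ) + 25) * (#(bSharp ω') : ℝ))) =
          (#(bSlots ω') : ℝ) / ((#(bSharp ω') : ℝ) + 25) by field_simp]
  refine le_trans ?_ hB
  rw [← sum_bSharpPairs (N + 2) g]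
  rw [← sum_bSlotPairs_eq_sum_bSharpPairs N (fun p => g (hexIns p.2.1 p.2.2.1 p.2.2.2.1 p.2.2.2.2 p.1)) (fun q => g q.1) fun p _ => rfl]
  rw [show ∑ ω ∈ bridgeFin N, (#(bSlots ω) : ℝ) * max 0 ((#(bSlots ω) : ℝ) - 324) /
      (((#(bSharp ω) : ℝ) + 25) * ((#(bSharp ω) : ℝ) + 50)) =
      ∑ ω ∈ bridgeFin N, (#(bSlots ω) : ℝ) * (max 0 ((#(bSlots ω) : ℝ) - 324) /
      (((#(bSharp ω) : ℝ) + 25) * ((#(bSharp ω) : ℝ) + 50))) from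
    sum_congr rfl fun ω _ => by rw [mul_div_assoc]]
  rw [← sum_bSlotPairs N (fun ω => max 0 ((#(bSlots ω) : ℝ) - 324) /
      (((#(bSharp ω) : ℝ) + 25) * ((#(bSharp ω) : ℝ) + 50)))]
  refine sum_le_sum fun p hp => ?_
  rw [bSlotPairs, Finset.mem_sigma] at hp
  obtain ⟨hω, hs⟩ := hp
  have hs' : (p.2.1, p.2.2.1, p.2.2.2.1, p.2.2.2.2) ∈ bSlots p.1 := hs
  set ω' := hexIns p.2.1 p.2.2.1 p.2.2.2.1 p.2.2.2.2 p.1 with hω'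
  have hJ1 : (1 : ℝ) ≤ #(bSharp ω') := by exact_mod_cast one_le_card_bSharp_hexIns hω hs'
  have hJ3 : (#(bSharp ω') : ℝ) ≤ #(bSharp p.1) + 25 := by
    exact_mod_cast card_bSharp_hexIns_le hω hs'
  have hI : (#(bSlots p.1) : ℝ) ≤ #(bSlots ω') + 324 := by
    exact_mod_cast card_bSlots_le_hexIns hω hs'
  have hJ0 : (0 : ℝ) ≤ #(bSharp p.1) := Nat.cast_nonneg _
  have hI0 : (0 : ℝ) ≤ #(bSlots ω') := Nat.cast_nonneg _
  show max 0 ((#(bSlots p.1) : ℝ) - 324) / (((#(bSharp p.1) : ℝ) + 25) * ((#(bSharp p.1) : ℝ) + 50)) ≤ g ω'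
  rw [hg]; simp only
  have hden : ((#(bSharp ω') : ℝ) + 25) * (#(bSharp ω') : ℝ) ≤
      ((#(bSharp p.1) : ℝ) + 25) * ((#(bSharp p.1) : ℝ) + 50) := by nlinarith
  have hden0 : 0 < ((#(bSharp ω') : ℝ) + 25) * (#(bSharp ω') : ℝ) := by positivity
  rcases le_or_gt ((#(bSlots p.1) : ℝ) - 324) 0 with hneg | hpos
  · rw [max_eq_left hneg, zero_div]
    exact div_nonneg hI0 hden0.le
  · rw [max_eq_right hpos.le]
    calc ((#(bSlots p.1) : ℝ) - 324) / (((#(bSharp p.1) : ℝ) + 25) * ((#(bSharp p.1) : ℝ) + 50))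
        ≤ ((#(bSlots p.1) : ℝ) - 324) / (((#(bSharp ω') : ℝ) + 25) * (#(bSharp ω') : ℝ)) :=
          div_le_div_of_nonneg_left hpos.le hden0 hden
      _ ≤ (#(bSlots ω') : ℝ) / (((#(bSharp ω') : ℝ) + 25) * (#(bSharp ω') : ℝ)) :=
          div_le_div_of_nonneg_right (by linarith) hden0.le

end TransferB

/-! ### (P3-B) Density of admissible deletion sites on bridges, from the exponential walk density and the
Hammersley–Welsh envelope for bridges -/

section DensityB

/-- The Hammersley–Welsh envelope of a-p6's `HexSAWBrickWallBridgeEnvelope`, all lengths: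
`μ_ℍ^N ≤ μ_ℍ · e^{6√N} · b_N(ℍ)` for `N ≥ 1` (from `μ^{N-1} ≤ c_{N-1} ≤ e^{6√(N-1)} b_N`).
[cite: MadrasSlade1993, Corollary 3.1.6, (3.1.9)] -/
theorem pow_le_mul_exp_mul_bridgeCount {N : ℕ} (hN : 1 ≤ N) :
    hexConnectiveConstant ^ N ≤ hexConnectiveConstant * Real.exp (6 * Real.sqrt N) * HexBW.bridgeCount N := by
  obtain ⟨n, rfl⟩ : ∃ n, N = n + 1 := ⟨N - 1, by omega⟩
  have hμ := hexConnectiveConstant_pos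
  have h1 := hexConnectiveConstant_pow_le n
  have h2 := HexBW.hexSawCount_le_exp_mul_bridgeCount n
  have h3 : Real.exp (6 * Real.sqrt n) ≤ Real.exp (6 * Real.sqrt ((n + 1 : ℕ) : ℝ)) :=
    Real.exp_le_exp.2 (mul_le_mul_of_nonneg_left (Real.sqrt_le_sqrt (by exact_mod_cast Nat.le_succ n))
      (by norm_num))
  have hb : (0 : ℝ) ≤ HexBW.bridgeCount (n + 1) := Nat.cast_nonneg _
  calc hexConnectiveConstant ^ (n + 1) = hexConnectiveConstant * hexConnectiveConstant ^ n := by ring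
    _ ≤ hexConnectiveConstant * (Real.exp (6 * Real.sqrt n) * HexBW.bridgeCount (n + 1)) :=
        mul_le_mul_of_nonneg_left (h1.trans h2) hμ.le
    _ ≤ hexConnectiveConstant * (Real.exp (6 * Real.sqrt ((n + 1 : ℕ) : ℝ)) * HexBW.bridgeCount (n + 1)) := by
        gcongr
    _ = hexConnectiveConstant * Real.exp (6 * Real.sqrt ((n + 1 : ℕ) : ℝ)) * HexBW.bridgeCount (n + 1) := by
        ring

/-- **(P3-B) per parity class**: the exponential density of deletion-poor WALKS (`DetourDensityHex`, K1′-ℍ),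
the band defect `J ≤ J_B + 1` and the Hammersley–Welsh envelope `μ^N ≤ μ e^{6√N} b_N` give
`#{ω ∈ B_{2m+δ}(ℍ) : J_B(ω) < m/(8Q)} ≤ C · b_{2m+δ}(ℍ)/m³`.
[cite: MadrasSlade1993, §7.3 (7.3.9)–(7.3.10) (proof of Theorem 7.3.2)] -/
theorem bridgeKesten_P3_of (h : DetourDensityHex) (δ : ℕ) :
    ∃ a > (0 : ℝ), ∃ C ≥ (0 : ℝ), ∀ m ≥ (1 : ℕ),
      (#((bridgeFin (2 * m + δ)).filter fun ω => ((#(bSharp ω) : ℕ) : ℝ) < a * m) : ℝ) ≤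
        C * #(bridgeFin (2 * m + δ)) / (m : ℝ) ^ 3 := by
  classical
  obtain ⟨Q, hQ, C₀, hC₀⟩ := h
  have hQr : (0 : ℝ) < Q := by exact_mod_cast hQ
  have hμ := hexConnectiveConstant_pos
  set CT : ℝ := max C₀ 0 * hexConnectiveConstant * (16 * Real.exp (81 * Q)) with hCT
  have hCT0 : 0 ≤ CT := by positivity
  refine ⟨1 / (8 * Q), by positivity, max CT ((8 * (Q : ℝ)) ^ 3), le_max_of_le_left hCT0, fun m hm => ?_⟩
  set N := 2 * m + δ with hNdef
  have hmr : (1 : ℝ) ≤ m := by exact_mod_cast hm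
  have hm0 : (0 : ℝ) < m := by linarith
  have hmN : m ≤ N := by omega
  have hN1 : 1 ≤ N := by omega
  have hB0 : (0 : ℝ) ≤ #(bridgeFin N) := Nat.cast_nonneg _
  by_cases hsmall : (m : ℝ) ≤ 8 * Q
  · -- small `m`: the trivial bound `# ≤ b_N ≤ (8Q)³ b_N / m³`
    have h1 : (#((bridgeFin N).filter fun ω => ((#(bSharp ω) : ℕ) : ℝ) < 1 / (8 * (Q : ℝ)) * m) : ℝ) ≤
        #(bridgeFin N) := by exact_mod_cast card_filter_le _ _
    have h2 : (#(bridgeFin N) : ℝ) ≤ (8 * (Q : ℝ)) ^ 3 * #(bridgeFin N) / (m : ℝ) ^ 3 := by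
      rw [le_div_iff₀ (by positivity)]
      have : (m : ℝ) ^ 3 ≤ (8 * (Q : ℝ)) ^ 3 := pow_le_pow_left₀ hm0.le hsmall 3
      nlinarith
    calc _ ≤ (#(bridgeFin N) : ℝ) := h1
      _ ≤ (8 * (Q : ℝ)) ^ 3 * #(bridgeFin N) / (m : ℝ) ^ 3 := h2
      _ ≤ max CT ((8 * (Q : ℝ)) ^ 3) * #(bridgeFin N) / (m : ℝ) ^ 3 := by
          gcongr; exact le_max_right _ _
  · push Not at hsmall
    -- Step 1: the filter lies in the walk-density event `J ≤ N/(4Q)`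
    have hsub : #((bridgeFin N).filter fun ω => ((#(bSharp ω) : ℕ) : ℝ) < 1 / (8 * (Q : ℝ)) * m) ≤
        {l : List HV | l ∈ sawLists hvGraph hvOrigin N ∧ #(hexSharp l) ≤ N / (4 * Q)}.ncard := by
      rw [← Set.ncard_coe_finset]
      have hfin : (sawLists hvGraph hvOrigin N).Finite := by
        rw [← coe_sawFin]; exact Finset.finite_toSet _
      refine Set.ncard_le_ncard ?_ (hfin.subset fun l hl => hl.1)
      intro ω hω
      rw [Finset.coe_filter, Set.mem_setOf_eq] at hω
      obtain ⟨hωB, hlt⟩ := hω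
      refine ⟨mem_sawFin_iff.1 (bridgeFin_subset N hωB), ?_⟩
      have hdef := card_hexSharp_le_card_bSharp_add_one hωB
      rw [Nat.le_div_iff_mul_le (by positivity)]
      rw [div_mul_eq_mul_div, one_mul, lt_div_iff₀ (by positivity)] at hlt
      -- hlt : J_B * (8Q) < m ; so (J_B + 1) * 4Q < m/2 + 4Q < m ≤ N
      have h' : ((#(hexSharp ω) * (4 * Q) : ℕ) : ℝ) < (N : ℝ) := by
        have hd : (#(hexSharp ω) : ℝ) ≤ #(bSharp ω) + 1 := by exact_mod_cast hdef
        have hmN' : (m : ℝ) ≤ N := by exact_mod_cast hmN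
        push_cast
        nlinarith
      exact_mod_cast h'.le
    -- Step 2: density bound, `μ^N ≤ μ e^{6√N} b_N`, and the tail
    have hhalf : (0 : ℝ) ≤ (1 / 2 : ℝ) ^ (N / Q) := by positivity
    have hsq : Real.sqrt (2 + Real.sqrt 2) ^ N = hexConnectiveConstant ^ N := by
      rw [← hexConnectiveConstant_eq_of_thm1 DuminilCopinSmirnov2012_thm1_holds]
    have henv := pow_le_mul_exp_mul_bridgeCount hN1
    rw [← card_bridgeFin] at henv
    have htail : (1 / 2 : ℝ) ^ (N / Q) * Real.exp (6 * Real.sqrt N) * (N : ℝ) ^ 3 ≤ 16 * Real.exp (81 * Q) := by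
      have h := half_pow_div_mul_exp_mul_cube_le hQ (by norm_num : (0 : ℝ) ≤ 6) N
      norm_num at h
      exact h
    have hNm : (m : ℝ) ^ 3 ≤ (N : ℝ) ^ 3 := pow_le_pow_left₀ hm0.le (by exact_mod_cast hmN) 3
    have hN0 : (0 : ℝ) < (N : ℝ) ^ 3 := by positivity
    calc (#((bridgeFin N).filter fun ω => ((#(bSharp ω) : ℕ) : ℝ) < 1 / (8 * (Q : ℝ)) * m) : ℝ)
        ≤ (({l : List HV | l ∈ sawLists hvGraph hvOrigin N ∧ #(hexSharp l) ≤ N / (4 * Q)}.ncard : ℕ) : ℝ) := by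
          exact_mod_cast hsub
      _ ≤ C₀ * (1 / 2 : ℝ) ^ (N / Q) * Real.sqrt (2 + Real.sqrt 2) ^ N := hC₀ N
      _ ≤ max C₀ 0 * (1 / 2 : ℝ) ^ (N / Q) * hexConnectiveConstant ^ N := by
          rw [hsq]; gcongr; exact le_max_left _ _
      _ ≤ max C₀ 0 * (1 / 2 : ℝ) ^ (N / Q) * (hexConnectiveConstant * Real.exp (6 * Real.sqrt N) * #(bridgeFin N)) :=
          mul_le_mul_of_nonneg_left henv (by positivity)
      _ = max C₀ 0 * hexConnectiveConstant * ((1 / 2 : ℝ) ^ (N / Q) * Real.exp (6 * Real.sqrt N) * (N : ℝ) ^ 3) *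
            #(bridgeFin N) / (N : ℝ) ^ 3 := by
          field_simp
      _ ≤ max C₀ 0 * hexConnectiveConstant * (16 * Real.exp (81 * Q)) * #(bridgeFin N) / (N : ℝ) ^ 3 := by
          gcongr
      _ = CT * #(bridgeFin N) / (N : ℝ) ^ 3 := by rw [hCT]
      _ ≤ CT * #(bridgeFin N) / (m : ℝ) ^ 3 := by
          apply div_le_div_of_nonneg_left (by positivity) (by positivity) hNm
      _ ≤ max CT ((8 * (Q : ℝ)) ^ 3) * #(bridgeFin N) / (m : ℝ) ^ 3 := by
          gcongr; exact le_max_left _ _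

end DensityB

/-! ### Assembly: the two-step Kesten inequality for honeycomb bridges -/

section AssemblyB

/-- **Crux K76 along one parity class** `N = 2m + δ`: the abstract no-growth assembly
`kesten_ineq_of_transfer_noGrowth` (a-p1) with `S m := bridgeFin (2m + δ)`, `I = I_B`, `J = J_B`, constants
`c₁ = 25`, `c₂ = 324`, `c₃ = 49`, `c₄ = 81`, `N₁ = 1`. [cite: MadrasSlade1993, Theorem 7.3.2 (proof, (7.3.5)–(7.3.11))] -/
theorem bridgeKestenTwo_parity (h : DetourDensityHex) {δ : ℕ} (hδ : δ ≤ 1) :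
    ∃ D : ℝ, ∀ᶠ m : ℕ in atTop,
      ((HexBW.bridgeCount (2 * m + δ + 2) : ℝ) / HexBW.bridgeCount (2 * m + δ)) ^ 2 - D / m ≤
        ((HexBW.bridgeCount (2 * m + δ + 2) : ℝ) / HexBW.bridgeCount (2 * m + δ)) *
          ((HexBW.bridgeCount (2 * m + δ + 2 + 2) : ℝ) / HexBW.bridgeCount (2 * m + δ + 2)) := by
  obtain ⟨a, ha, C, hC0, hC⟩ := bridgeKesten_P3_of h δ
  have hidx1 : ∀ m : ℕ, 2 * (m + 1) + δ = 2 * m + δ + 2 := fun m => by ring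
  have hidx2 : ∀ m : ℕ, 2 * (m + 2) + δ = 2 * m + δ + 2 + 2 := fun m => by ring
  have key := kesten_ineq_of_transfer_noGrowth (α := List HV) (fun m => bridgeFin (2 * m + δ))
    (fun _ ω => #(bSlots ω)) (fun _ ω => #(bSharp ω)) 1 (a := a) (C := C)
    (c₁ := 25) (c₂ := 324) (c₃ := 49) (c₄ := 81) ha hC0 (by norm_num) (by norm_num) (by norm_num) (by norm_num)
    (fun m _ => by rw [card_bridgeFin]; exact HexBW.one_le_bridgeCount _)
    (fun m hm ω hω => by
      have h := card_bSlots_le ω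
      have hl := length_of_mem_sawFin (bridgeFin_subset _ hω)
      have h' : #(bSlots ω) ≤ 81 * m := by rw [hl] at h; clear hω; omega
      calc ((#(bSlots ω) : ℕ) : ℝ) ≤ ((81 * m : ℕ) : ℝ) := by exact_mod_cast h'
        _ = 81 * (m : ℝ) := by push_cast; ring)
    (fun m _ => by simp only [hidx1]; exact bridgeKesten_P1' (2 * m + δ))
    (fun m _ => by
      simp only [hidx2]
      refine le_trans (sum_le_sum fun ω _ => ?_) (bridgeKesten_P2 (2 * m + δ))
      set I : ℝ := (#(bSlots ω) : ℝ)
      set J : ℝ := (#(bSharp ω) : ℝ)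
      have hI0 : 0 ≤ I := Nat.cast_nonneg _
      have hJ0 : 0 ≤ J := Nat.cast_nonneg _
      have hden : 0 < (J + 25) * (J + 50) := by positivity
      have hden' : 0 < (J + 49) * (J + 49 + 1) := by positivity
      by_cases h324 : 324 ≤ I
      · have hmax : max 0 (I - 324) = I - 324 := max_eq_right (by linarith)
        rw [hmax]
        apply div_le_div_of_nonneg_left (by nlinarith) hden
        nlinarith
      · have hneg : I * (I - 324) / ((J + 49) * (J + 49 + 1)) ≤ 0 :=
          div_nonpos_of_nonpos_of_nonneg (by nlinarith) hden'.le
        have hpos : 0 ≤ I * max 0 (I - 324) / ((J + 25) * (J + 50)) := by positivity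
        linarith)
    (fun m _ hm => hC m hm)
  obtain ⟨D, hD⟩ := key
  refine ⟨D, ?_⟩
  filter_upwards [hD] with m hm'
  simpa only [hidx1, hidx2, card_bridgeFin] using hm'

/-- **Crux K76 «HEX-BRIDGE-KESTEN-2»: the two-step Kesten inequality for bridges of the honeycomb lattice**,
`φ_N² − D/N ≤ φ_N φ_{N+2}` eventually, `φ_N = b_{N+2}(ℍ)/b_N(ℍ)` — hypothesis (7.3.4) of Madras–Slade's Lemma 7.3.1
for `a_N = b_N(ℍ)`, obtained by the hexagon surgery of `HexSAWHexagonSurgery` RESTRICTED TO BRIDGES (insertion slots and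
deletion sites windowed in the band `(0, ht ω_N]`), the pattern-free density `DetourDensityHex` (K1′-ℍ) transported to
bridges by the Hammersley–Welsh envelope, and the no-growth assembly `kesten_ineq_of_transfer_noGrowth`. Status in print:
for `ℤ^d`, Kesten's inequality for bridges is Madras–Slade Theorem 7.3.2(b) ((7.3.4), p. 244), explicit and proved, and it is
in the tree (`Zd.MadrasSlade1993_thm732b`); for `ℍ` nothing is printed — this is the honeycomb port of that chapter, first
written and kernel-checked here (lane «pcv-sawmu» R76, planner a-idea-1's face `HexBridgeKestenTwo`).
[cite: MadrasSlade1993, Theorem 7.3.2 (b) (7.3.4), p. 244; Lemma 7.3.1 (iii) (7.3.1)] -/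
theorem hexBridgeKestenTwo_of (h : DetourDensityHex) :
    ∃ D : ℝ, ∀ᶠ N : ℕ in atTop,
      ((HexBW.bridgeCount (N + 2) : ℝ) / HexBW.bridgeCount N) ^ 2 - D / N ≤
        ((HexBW.bridgeCount (N + 2) : ℝ) / HexBW.bridgeCount N) *
          ((HexBW.bridgeCount (N + 4) : ℝ) / HexBW.bridgeCount (N + 2)) :=
  kestenIneqTwo_of_parity (φ := fun N => (HexBW.bridgeCount (N + 2) : ℝ) / HexBW.bridgeCount N) fun δ hδ =>
    bridgeKestenTwo_parity h (δ := δ) hδ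


/-- **The lower envelope face `HexBridgeLo` of R76, all lengths: `e^{−9√n} μ_ℍ^n ≤ b_n(ℍ)`** (from
`μ^n ≤ μ e^{6√n} b_n` and `μ_ℍ ≤ 37/20 ≤ e^{3√n}`). [cite: MadrasSlade1993, Corollary 3.1.6, (3.1.9)] -/
theorem hexBridgeLo (n : ℕ) :
    Real.exp (-(9 * Real.sqrt n)) * hexConnectiveConstant ^ n ≤ HexBW.bridgeCount n := by
  rcases Nat.eq_zero_or_pos n with rfl | hn
  · have : 1 ≤ HexBW.bridgeCount 0 := HexBW.one_le_bridgeCount 0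
    simp only [Nat.cast_zero, Real.sqrt_zero, mul_zero, neg_zero, Real.exp_zero, pow_zero, one_mul]
    exact_mod_cast this
  have hμ := hexConnectiveConstant_pos
  have h1 := pow_le_mul_exp_mul_bridgeCount (N := n) hn
  set s : ℝ := Real.sqrt n with hs
  have hs1 : 1 ≤ s := by
    rw [hs, Real.le_sqrt (by norm_num) (Nat.cast_nonneg _)]; exact_mod_cast hn
  have hμe : hexConnectiveConstant ≤ Real.exp (3 * s) := by
    have hμ2 : hexConnectiveConstant ≤ 37 / 20 := hexConnectiveConstant_le.1
    calc hexConnectiveConstant ≤ 3 * s + 1 := by linarith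
      _ ≤ Real.exp (3 * s) := Real.add_one_le_exp _
  have hb : (0 : ℝ) ≤ HexBW.bridgeCount n := Nat.cast_nonneg _
  have h2 : hexConnectiveConstant ^ n ≤ Real.exp (9 * s) * HexBW.bridgeCount n := by
    calc hexConnectiveConstant ^ n ≤ hexConnectiveConstant * Real.exp (6 * s) * HexBW.bridgeCount n := h1
      _ ≤ Real.exp (3 * s) * Real.exp (6 * s) * HexBW.bridgeCount n := by gcongr
      _ = Real.exp (9 * s) * HexBW.bridgeCount n := by rw [← Real.exp_add]; ring_nf
  rw [Real.exp_neg, inv_mul_le_iff₀ (Real.exp_pos _)]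
  exact h2

/-- **R76 crux K76, unconditional**: the two-step Kesten inequality for bridges of the honeycomb lattice, with
`DetourDensityHex` discharged by K1′-ℍ (`HexSAWRunDensity`); the `ℤ^d` twin is M–S Theorem 7.3.2(b) (tree
`Zd.MadrasSlade1993_thm732b`). [cite: MadrasSlade1993, Theorem 7.3.2 (b) (7.3.4), p. 244; Lemma 7.3.1 (iii) (7.3.1)] -/
theorem hexBridgeKestenTwo :
    ∃ D : ℝ, ∀ᶠ N : ℕ in atTop,
      ((HexBW.bridgeCount (N + 2) : ℝ) / HexBW.bridgeCount N) ^ 2 - D / N ≤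
        ((HexBW.bridgeCount (N + 2) : ℝ) / HexBW.bridgeCount N) *
          ((HexBW.bridgeCount (N + 4) : ℝ) / HexBW.bridgeCount (N + 2)) :=
  hexBridgeKestenTwo_of DetourDensityHex_holds

end AssemblyB

end Literature.Probability.RandomPlanarGeometry.SAW.HV
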